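import Summits.AtomisticToContinuum.HydrodynamicLimit.Theorems.TwoClocksEquilibriumShearWindowLDTestFunctions

/-!
# `EquilibriumShearWindowLD`: the good test functions form a linear subspace, and a uniform bound
# on a sup-norm-dense class suffices (route TwoClocks, stmt-AtomisticToContinuum-14446)

Helper file (`--supports` stmt-AtomisticToContinuum-14446), companion of
`TwoClocksEquilibriumShearWindowLDTestFunctions.lean` (linearity of the window functional in `φ`,
Cauchy–Schwarz, small test functions, all windows per test function, convexity in `φ`). Write `Good(φ)` for the item's
conclusion for `φ` at fixed `σ, a₀, θ₀` and flow family
(`∃ β₀ > 0 ∀ |β| ≤ β₀ ∀ ε > 0 ∃ τ > 0 ∃ N₀ ∀ N ≥ N₀, M_N(β, τ; φ) ≤ exp(ε(N+1))`).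

* `shearGood_const_mul`, `shearGood_add` — **`Good` is a linear subspace of `C(𝕋³)`** (scalars:
  `W(cφ) = cW(φ)`, tilt `βc`; sums: halve the tilt range, synchronise the two windows by the
  all-windows upgrade, Cauchy–Schwarz);
* `shearGood_of_uniform_dense`, `equilibriumShearWindowLD_of_uniform_dense` — **uniform dense classes
  suffice**: if a set `S` of continuous test functions approximates `φ` in sup norm and carries a
  tilt range UNIFORM in units of the sup norm (`|β| B ≤ β₀` whenever `ψ ∈ S`, `|ψ| ≤ B`), then
  `Good(φ)` with `β₀(φ) = β₀/(2(‖φ‖_∞+1))` (approximate within `δ = δ(β, ε, θ₀)`, apply the class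
  bound at tilt `2β`, pay `exp(|β|δ(2 + 24θ₀)(N+1))` for the remainder);
* `exists_trigPoly_re_near`, `equilibriumShearWindowLD_of_uniform_trigPoly` — the concrete class of
  real parts of trigonometric polynomials (Mathlib's `UnitAddTorus.span_mFourier_closure_eq_top`):
  **the item reduces to the test functions `Re P`, `P` a trigonometric polynomial on `𝕋³`, with a
  sup-norm-uniform tilt range.**

Why uniformity (and why `Good` is not shown to be sup-norm closed): approximating `φ` by `ψ_δ`,
`‖φ - ψ_δ‖_∞ ≤ δ`, costs only a rate `≈ |β|δ(2 + 24θ₀)`, but the bound for `ψ_δ` is consumed at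
the tilt `2β`, and a `ψ`-dependent range `β₀(ψ_δ)` may tend to `0` along `δ → 0`, whereas the item
fixes `β` BEFORE `ε`; likewise modewise bounds do not suffice (Hölder over the `|K|` modes of an
approximant multiplies the tilt by `|K|`; convex combinations, by contrast, cost no tilt,
`shearWindowMoment_convex_le`). A range uniform in `‖ψ‖_∞` (physically
`β₀ ≍ 1/(‖ψ‖_∞ θ₀)`, the Gaussian range of the static moment) removes the obstruction; it is also
what an `ε`-net over a compact family of test functions (the route's dock) consumes. Nothing
dynamical is proved here: the item stays open.

References: S. Olla, S. R. S. Varadhan, H.-T. Yau, Comm. Math. Phys. 155 (1993) 523, §2;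
Mathlib `Mathlib.Analysis.Fourier.AddCircleMulti` (Stone–Weierstrass on `UnitAddTorus`).

prover-pitem-stmt-AtomisticToContinuum-14446-c3-0.
-/

noncomputable section

open MeasureTheory Real Set
open scoped ENNReal

namespace Summit.AtomisticToContinuum.HydrodynamicLimit.Theorems

open Literature.Analysis.FluidPDE Literature.MathematicalPhysics.KineticTheory
open Summit.AtomisticToContinuum.HydrodynamicLimit.Theses.TwoClocks

/-! ### `Good` is a linear subspace of the test functions -/

/-- **Closure under scalars.** If the item's conclusion holds for the test function `φ` (with tilt
range `β₀`), it holds for `c φ` (with tilt range `β₀/(|c| + 1)`): `W(cφ) = cW(φ)`, so the moment at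
tilt `β` for `cφ` is the moment at tilt `βc` for `φ`. [folklore] -/
theorem shearGood_const_mul {σ a₀ θ₀ : ℝ}
    (Φ : (N : ℕ) → HardSphereFlow (Torus.geometry (Fin 3)) (hsDiameter σ N) (N + 1))
    (φ : T3 → ℝ) (c : ℝ)
    (h : ∃ β₀ : ℝ, 0 < β₀ ∧ ∀ β : ℝ, |β| ≤ β₀ → ∀ ε : ℝ, 0 < ε → ∃ τ : ℝ, 0 < τ ∧ ∃ N₀ : ℕ,
      ∀ N : ℕ, N₀ ≤ N →
        ∫⁻ z, ENNReal.ofReal (Real.exp (β * ∑ i : Fin (N + 1),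
            (τ * ((N : ℝ) + 1) ^ (-(1 / 3 : ℝ)))⁻¹ *
              ∫ r in (0 : ℝ)..(τ * ((N : ℝ) + 1) ^ (-(1 / 3 : ℝ))),
                φ ((Φ N).flow r z i).1 * (((Φ N).flow r z i).2 0 * ((Φ N).flow r z i).2 1)))
            ∂(localGibbsLaw σ (fun _ => a₀) (fun _ => 0) (fun _ => θ₀) N (Φ N)) ≤
          ENNReal.ofReal (Real.exp (ε * ((N : ℝ) + 1)))) :
    ∃ β₀ : ℝ, 0 < β₀ ∧ ∀ β : ℝ, |β| ≤ β₀ → ∀ ε : ℝ, 0 < ε → ∃ τ : ℝ, 0 < τ ∧ ∃ N₀ : ℕ,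
      ∀ N : ℕ, N₀ ≤ N →
        ∫⁻ z, ENNReal.ofReal (Real.exp (β * ∑ i : Fin (N + 1),
            (τ * ((N : ℝ) + 1) ^ (-(1 / 3 : ℝ)))⁻¹ *
              ∫ r in (0 : ℝ)..(τ * ((N : ℝ) + 1) ^ (-(1 / 3 : ℝ))),
                c * φ ((Φ N).flow r z i).1 * (((Φ N).flow r z i).2 0 * ((Φ N).flow r z i).2 1)))
            ∂(localGibbsLaw σ (fun _ => a₀) (fun _ => 0) (fun _ => θ₀) N (Φ N)) ≤
          ENNReal.ofReal (Real.exp (ε * ((N : ℝ) + 1))) := by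
  obtain ⟨β₀, hβ₀, h⟩ := h
  refine ⟨β₀ / (|c| + 1), by positivity, fun β hβ ε hε => ?_⟩
  have hβc : |β * c| ≤ β₀ := by
    rw [abs_mul]
    have h1 : |β| * |c| ≤ β₀ / (|c| + 1) * |c| := mul_le_mul_of_nonneg_right hβ (abs_nonneg c)
    have h2 : β₀ / (|c| + 1) * |c| ≤ β₀ := by
      rw [div_mul_eq_mul_div, div_le_iff₀ (by positivity)]
      nlinarith [abs_nonneg c]
    exact h1.trans h2
  obtain ⟨τ, hτ, N₀, hN⟩ := h (β * c) hβc ε hε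
  refine ⟨τ, hτ, N₀, fun N hNN => ?_⟩
  refine le_of_eq_of_le (lintegral_congr fun z => ?_) (hN N hNN)
  rw [shearWindowSum_const_mul, ← mul_assoc]

/-- **Closure under sums.** Under the global Gibbs law at rest (`a₀, θ₀ > 0`, `0 < σ ≤ 1/2`): if the
item's conclusion holds for the continuous test functions `φ` and `ψ`, it holds for `φ + ψ`. Take
`β₀` below half of the two tilt ranges and of the two a priori ranges
(`equilibriumShearWindowLD_apriori`); given `β`, `ε`, get the two windows at tilt `2β` and `ε/2`,
upgrade each to all long windows (`shearWindowMoment_allWindows_of_one`, `η = ε/2`) so that ONE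
window serves both, and conclude by Cauchy–Schwarz (`shearWindowMoment_add_le`). [folklore] -/
theorem shearGood_add {a₀ θ₀ : ℝ} (ha : 0 < a₀) (hθ : 0 < θ₀) {σ : ℝ} (hσ : 0 < σ)
    (hσ2 : σ ≤ 1 / 2)
    (Φ : (N : ℕ) → HardSphereFlow (Torus.geometry (Fin 3)) (hsDiameter σ N) (N + 1))
    {φ ψ : T3 → ℝ} (hφ : Continuous φ) (hψ : Continuous ψ)
    (h₁ : ∃ β₀ : ℝ, 0 < β₀ ∧ ∀ β : ℝ, |β| ≤ β₀ → ∀ ε : ℝ, 0 < ε → ∃ τ : ℝ, 0 < τ ∧ ∃ N₀ : ℕ,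
      ∀ N : ℕ, N₀ ≤ N →
        ∫⁻ z, ENNReal.ofReal (Real.exp (β * ∑ i : Fin (N + 1),
            (τ * ((N : ℝ) + 1) ^ (-(1 / 3 : ℝ)))⁻¹ *
              ∫ r in (0 : ℝ)..(τ * ((N : ℝ) + 1) ^ (-(1 / 3 : ℝ))),
                φ ((Φ N).flow r z i).1 * (((Φ N).flow r z i).2 0 * ((Φ N).flow r z i).2 1)))
            ∂(localGibbsLaw σ (fun _ => a₀) (fun _ => 0) (fun _ => θ₀) N (Φ N)) ≤
          ENNReal.ofReal (Real.exp (ε * ((N : ℝ) + 1))))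
    (h₂ : ∃ β₀ : ℝ, 0 < β₀ ∧ ∀ β : ℝ, |β| ≤ β₀ → ∀ ε : ℝ, 0 < ε → ∃ τ : ℝ, 0 < τ ∧ ∃ N₀ : ℕ,
      ∀ N : ℕ, N₀ ≤ N →
        ∫⁻ z, ENNReal.ofReal (Real.exp (β * ∑ i : Fin (N + 1),
            (τ * ((N : ℝ) + 1) ^ (-(1 / 3 : ℝ)))⁻¹ *
              ∫ r in (0 : ℝ)..(τ * ((N : ℝ) + 1) ^ (-(1 / 3 : ℝ))),
                ψ ((Φ N).flow r z i).1 * (((Φ N).flow r z i).2 0 * ((Φ N).flow r z i).2 1)))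
            ∂(localGibbsLaw σ (fun _ => a₀) (fun _ => 0) (fun _ => θ₀) N (Φ N)) ≤
          ENNReal.ofReal (Real.exp (ε * ((N : ℝ) + 1)))) :
    ∃ β₀ : ℝ, 0 < β₀ ∧ ∀ β : ℝ, |β| ≤ β₀ → ∀ ε : ℝ, 0 < ε → ∃ τ : ℝ, 0 < τ ∧ ∃ N₀ : ℕ,
      ∀ N : ℕ, N₀ ≤ N →
        ∫⁻ z, ENNReal.ofReal (Real.exp (β * ∑ i : Fin (N + 1),
            (τ * ((N : ℝ) + 1) ^ (-(1 / 3 : ℝ)))⁻¹ *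
              ∫ r in (0 : ℝ)..(τ * ((N : ℝ) + 1) ^ (-(1 / 3 : ℝ))),
                (φ ((Φ N).flow r z i).1 + ψ ((Φ N).flow r z i).1) *
                  (((Φ N).flow r z i).2 0 * ((Φ N).flow r z i).2 1)))
            ∂(localGibbsLaw σ (fun _ => a₀) (fun _ => 0) (fun _ => θ₀) N (Φ N)) ≤
          ENNReal.ofReal (Real.exp (ε * ((N : ℝ) + 1))) := by
  obtain ⟨β₁, hβ₁, H₁⟩ := h₁
  obtain ⟨β₂, hβ₂, H₂⟩ := h₂
  obtain ⟨γ₁, hγ₁, A₁⟩ := equilibriumShearWindowLD_apriori ha hθ hσ hσ2 Φ hφ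
  obtain ⟨γ₂, hγ₂, A₂⟩ := equilibriumShearWindowLD_apriori ha hθ hσ hσ2 Φ hψ
  refine ⟨min (min β₁ β₂) (min γ₁ γ₂) / 2, by positivity, fun β hβ ε hε => ?_⟩
  have h2β : |2 * β| = 2 * |β| := by rw [abs_mul, abs_two]
  have hb₁ : |2 * β| ≤ β₁ := by
    rw [h2β]; linarith [min_le_left (min β₁ β₂) (min γ₁ γ₂), min_le_left β₁ β₂]
  have hb₂ : |2 * β| ≤ β₂ := by
    rw [h2β]; linarith [min_le_left (min β₁ β₂) (min γ₁ γ₂), min_le_right β₁ β₂]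
  have hg₁ : |2 * β| ≤ γ₁ := by
    rw [h2β]; linarith [min_le_right (min β₁ β₂) (min γ₁ γ₂), min_le_left γ₁ γ₂]
  have hg₂ : |2 * β| ≤ γ₂ := by
    rw [h2β]; linarith [min_le_right (min β₁ β₂) (min γ₁ γ₂), min_le_right γ₁ γ₂]
  have hε2 : 0 < ε / 2 := half_pos hε
  obtain ⟨c₁, hc₁⟩ := A₁ (2 * β) hg₁
  obtain ⟨c₂, hc₂⟩ := A₂ (2 * β) hg₂
  obtain ⟨τ₁, hτ₁, N₁, hN₁⟩ := H₁ (2 * β) hb₁ (ε / 2) hε2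
  obtain ⟨τ₂, hτ₂, N₂, hN₂⟩ := H₂ (2 * β) hb₂ (ε / 2) hε2
  obtain ⟨T₁, hT₁, hall₁⟩ := shearWindowMoment_allWindows_of_one σ a₀ θ₀ Φ hφ hc₁ hτ₁ hε2.le hN₁ hε2
  obtain ⟨T₂, hT₂, hall₂⟩ := shearWindowMoment_allWindows_of_one σ a₀ θ₀ Φ hψ hc₂ hτ₂ hε2.le hN₂ hε2
  refine ⟨max T₁ T₂, lt_max_of_lt_left hT₁, max N₁ N₂, fun N hNN => ?_⟩
  have hw := hall₁ (max T₁ T₂) (le_max_left _ _) N ((le_max_left _ _).trans hNN)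
  have hw' := hall₂ (max T₁ T₂) (le_max_right _ _) N ((le_max_right _ _).trans hNN)
  have hεε : ε / 2 + ε / 2 = ε := by ring
  rw [hεε] at hw hw'
  refine (shearWindowMoment_add_le σ a₀ θ₀ N (Φ N) hφ hψ β _).trans ?_
  have h0 : (0 : ℝ) ≤ 1 / 2 := by norm_num
  calc (∫⁻ z, ENNReal.ofReal (Real.exp ((2 * β) * ∑ i : Fin (N + 1),
          ((max T₁ T₂) * ((N : ℝ) + 1) ^ (-(1 / 3 : ℝ)))⁻¹ *
            ∫ r in (0 : ℝ)..((max T₁ T₂) * ((N : ℝ) + 1) ^ (-(1 / 3 : ℝ))),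
              φ ((Φ N).flow r z i).1 * (((Φ N).flow r z i).2 0 * ((Φ N).flow r z i).2 1)))
          ∂(localGibbsLaw σ (fun _ => a₀) (fun _ => 0) (fun _ => θ₀) N (Φ N))) ^ (1 / 2 : ℝ) *
        (∫⁻ z, ENNReal.ofReal (Real.exp ((2 * β) * ∑ i : Fin (N + 1),
          ((max T₁ T₂) * ((N : ℝ) + 1) ^ (-(1 / 3 : ℝ)))⁻¹ *
            ∫ r in (0 : ℝ)..((max T₁ T₂) * ((N : ℝ) + 1) ^ (-(1 / 3 : ℝ))),
              ψ ((Φ N).flow r z i).1 * (((Φ N).flow r z i).2 0 * ((Φ N).flow r z i).2 1)))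
          ∂(localGibbsLaw σ (fun _ => a₀) (fun _ => 0) (fun _ => θ₀) N (Φ N))) ^ (1 / 2 : ℝ)
      ≤ ENNReal.ofReal (Real.exp (ε * ((N : ℝ) + 1))) ^ (1 / 2 : ℝ) *
          ENNReal.ofReal (Real.exp (ε * ((N : ℝ) + 1))) ^ (1 / 2 : ℝ) :=
        mul_le_mul' (ENNReal.rpow_le_rpow hw h0) (ENNReal.rpow_le_rpow hw' h0)
    _ = ENNReal.ofReal (Real.exp (ε * ((N : ℝ) + 1))) := by
        rw [← ENNReal.rpow_add_of_nonneg _ _ h0 h0]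
        norm_num

/-! ### Uniform dense classes suffice -/

/-- **A uniform bound on a sup-norm-dense class gives the item's conclusion for `φ`.** Under the
global Gibbs law at rest (`a₀, θ₀ > 0`, `σ ≤ 1/2`) and a flow family, let `S` be a set of test
functions carrying a tilt range `β₀` UNIFORM IN UNITS OF THE SUP NORM — for every continuous
`ψ ∈ S` with `|ψ| ≤ B` and every tilt with `|β| B ≤ β₀`, for every `ε > 0` some window gives
`M_N(β, τ; ψ) ≤ exp(ε(N+1))` eventually in `N` — and suppose `φ` is continuous and approximable:
for every `δ > 0` some continuous `ψ ∈ S` has `|φ - ψ| ≤ δ`. Then `Good(φ)` with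
`β₀(φ) = β₀ / (2(‖φ‖_∞ + 1))`: given `|β| ≤ β₀(φ)` and `ε`, choose `δ ≤ 1` with
`|β|δ(2 + 24θ₀) ≤ ε`, `16|β|δθ₀ ≤ 1`, approximate, apply the class bound to `ψ` at tilt `2β` and
`ε/2`, and combine by Cauchy–Schwarz (`shearWindowMoment_add_le`) with the cost of the small
remainder `φ - ψ` (`shearWindowMoment_le_of_abs_le`, `one_sub_rpow_neg_three_halves_le`).
[folklore] -/
theorem shearGood_of_uniform_dense {a₀ θ₀ : ℝ} (ha : 0 < a₀) (hθ : 0 < θ₀) {σ : ℝ}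
    (hσ2 : σ ≤ 1 / 2)
    (Φ : (N : ℕ) → HardSphereFlow (Torus.geometry (Fin 3)) (hsDiameter σ N) (N + 1))
    (S : Set (T3 → ℝ)) {β₀ : ℝ} (hβ₀ : 0 < β₀)
    (hS : ∀ ψ ∈ S, Continuous ψ → ∀ B : ℝ, (∀ x, |ψ x| ≤ B) → ∀ β : ℝ, |β| * B ≤ β₀ →
      ∀ ε : ℝ, 0 < ε → ∃ τ : ℝ, 0 < τ ∧ ∃ N₀ : ℕ, ∀ N : ℕ, N₀ ≤ N →
        ∫⁻ z, ENNReal.ofReal (Real.exp (β * ∑ i : Fin (N + 1),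
            (τ * ((N : ℝ) + 1) ^ (-(1 / 3 : ℝ)))⁻¹ *
              ∫ r in (0 : ℝ)..(τ * ((N : ℝ) + 1) ^ (-(1 / 3 : ℝ))),
                ψ ((Φ N).flow r z i).1 * (((Φ N).flow r z i).2 0 * ((Φ N).flow r z i).2 1)))
            ∂(localGibbsLaw σ (fun _ => a₀) (fun _ => 0) (fun _ => θ₀) N (Φ N)) ≤
          ENNReal.ofReal (Real.exp (ε * ((N : ℝ) + 1))))
    {φ : T3 → ℝ} (hφ : Continuous φ)
    (hd : ∀ δ : ℝ, 0 < δ → ∃ ψ ∈ S, Continuous ψ ∧ ∀ x, |φ x - ψ x| ≤ δ) :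
    ∃ β₀ : ℝ, 0 < β₀ ∧ ∀ β : ℝ, |β| ≤ β₀ → ∀ ε : ℝ, 0 < ε → ∃ τ : ℝ, 0 < τ ∧ ∃ N₀ : ℕ,
      ∀ N : ℕ, N₀ ≤ N →
        ∫⁻ z, ENNReal.ofReal (Real.exp (β * ∑ i : Fin (N + 1),
            (τ * ((N : ℝ) + 1) ^ (-(1 / 3 : ℝ)))⁻¹ *
              ∫ r in (0 : ℝ)..(τ * ((N : ℝ) + 1) ^ (-(1 / 3 : ℝ))),
                φ ((Φ N).flow r z i).1 * (((Φ N).flow r z i).2 0 * ((Φ N).flow r z i).2 1)))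
            ∂(localGibbsLaw σ (fun _ => a₀) (fun _ => 0) (fun _ => θ₀) N (Φ N)) ≤
          ENNReal.ofReal (Real.exp (ε * ((N : ℝ) + 1))) := by
  -- sup norm of `φ`
  obtain ⟨Bφ, hBφ⟩ := isCompact_univ.exists_bound_of_continuousOn (hφ.continuousOn (s := univ))
  have hBφ' : ∀ x, |φ x| ≤ Bφ := fun x => by simpa [Real.norm_eq_abs] using hBφ x (mem_univ _)
  have hB0 : 0 ≤ Bφ := (abs_nonneg _).trans (hBφ' 0)
  refine ⟨β₀ / (2 * (Bφ + 1)), by positivity, fun β hβ ε hε => ?_⟩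
  -- the perturbation size `δ`
  set δ : ℝ := min 1 (min (1 / (16 * (|β| + 1) * θ₀)) (ε / ((|β| + 1) * (2 + 24 * θ₀)))) with hδdef
  have hβ1 : 0 < |β| + 1 := by positivity
  have hδ0 : 0 < δ := by
    rw [hδdef]
    exact lt_min one_pos (lt_min (by positivity) (by positivity))
  have hδ1 : δ ≤ 1 := min_le_left _ _
  have hδ2 : δ ≤ 1 / (16 * (|β| + 1) * θ₀) := (min_le_right _ _).trans (min_le_left _ _)
  have hδ3 : δ ≤ ε / ((|β| + 1) * (2 + 24 * θ₀)) := (min_le_right _ _).trans (min_le_right _ _)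
  -- `x := 8|β|δθ₀ ≤ 1/2` and the rate `|β|δ(2 + 24θ₀) ≤ ε`
  have hx : 8 * |β| * δ * θ₀ ≤ 1 / 2 := by
    have h1 : δ * (16 * (|β| + 1) * θ₀) ≤ 1 := by
      rwa [le_div_iff₀ (by positivity)] at hδ2
    nlinarith [abs_nonneg β, hδ0.le, hθ.le]
  have hrate : |β| * δ * (2 + 24 * θ₀) ≤ ε := by
    have h1 : δ * ((|β| + 1) * (2 + 24 * θ₀)) ≤ ε := by
      rwa [le_div_iff₀ (by positivity)] at hδ3
    nlinarith [abs_nonneg β, hδ0.le, hθ.le]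
  -- approximate `φ` by `ψ ∈ S`, `|ψ| ≤ Bφ + 1`
  obtain ⟨ψ, hψS, hψ, hφψ⟩ := hd δ hδ0
  have hψB : ∀ x, |ψ x| ≤ Bφ + 1 := by
    intro x
    have h1 := hBφ' x
    have h2 := hφψ x
    have h3 : |ψ x| ≤ |φ x| + |φ x - ψ x| := by
      calc |ψ x| = |φ x - (φ x - ψ x)| := by ring_nf
        _ ≤ |φ x| + |φ x - ψ x| := abs_sub _ _
    linarith
  have h2β : |2 * β| = 2 * |β| := by rw [abs_mul, abs_two]
  have htilt : |2 * β| * (Bφ + 1) ≤ β₀ := by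
    rw [h2β]
    have h1 : |β| * (2 * (Bφ + 1)) ≤ β₀ := by rwa [le_div_iff₀ (by positivity)] at hβ
    linarith
  have hε2 : 0 < ε / 2 := half_pos hε
  obtain ⟨τ, hτ, N₀, hN⟩ := hS ψ hψS hψ (Bφ + 1) hψB (2 * β) htilt (ε / 2) hε2
  refine ⟨τ, hτ, N₀, fun N hNN => ?_⟩
  set w : ℝ := τ * ((N : ℝ) + 1) ^ (-(1 / 3 : ℝ)) with hw
  have hw0 : 0 < w := mul_pos hτ (Real.rpow_pos_of_pos (by positivity) _)
  set χ : T3 → ℝ := fun x => φ x - ψ x with hχ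
  have hχc : Continuous χ := hφ.sub hψ
  have hχδ : ∀ x, |χ x| ≤ δ := hφψ
  -- `φ = ψ + χ`
  have hsplit : ∫⁻ z, ENNReal.ofReal (Real.exp (β * ∑ i : Fin (N + 1), w⁻¹ * ∫ r in (0 : ℝ)..w,
        φ ((Φ N).flow r z i).1 * (((Φ N).flow r z i).2 0 * ((Φ N).flow r z i).2 1)))
        ∂(localGibbsLaw σ (fun _ => a₀) (fun _ => 0) (fun _ => θ₀) N (Φ N)) =
      ∫⁻ z, ENNReal.ofReal (Real.exp (β * ∑ i : Fin (N + 1), w⁻¹ * ∫ r in (0 : ℝ)..w,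
        (ψ ((Φ N).flow r z i).1 + χ ((Φ N).flow r z i).1) *
          (((Φ N).flow r z i).2 0 * ((Φ N).flow r z i).2 1)))
        ∂(localGibbsLaw σ (fun _ => a₀) (fun _ => 0) (fun _ => θ₀) N (Φ N)) := by
    refine lintegral_congr fun z => ?_
    simp only [hχ, add_sub_cancel]
  rw [hsplit]
  refine (shearWindowMoment_add_le σ a₀ θ₀ N (Φ N) hψ hχc β w).trans ?_
  -- the two factors
  have hψN := hN N hNN
  have h4 : 4 * |2 * β| * δ * θ₀ < 1 := by rw [h2β]; linarith
  have hχN := shearWindowMoment_le_of_abs_le ha hθ hσ2 N (Φ N) hχδ h4 hw0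
  have hN1 : (0 : ℝ) < (N : ℝ) + 1 := by positivity
  -- the constant of the small factor is `≤ exp(ε)`
  have hK : Real.exp (|2 * β| * δ) * (1 - 4 * |2 * β| * δ * θ₀) ^ (-(3 : ℝ) / 2) ≤ Real.exp ε := by
    rw [h2β]
    have hx0 : 0 ≤ 8 * |β| * δ * θ₀ := by positivity
    have h1 : (1 - 4 * (2 * |β|) * δ * θ₀) ^ (-(3 : ℝ) / 2) ≤ Real.exp (3 * (8 * |β| * δ * θ₀)) := by
      have := one_sub_rpow_neg_three_halves_le hx0 hx
      convert this using 2; ring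
    calc Real.exp (2 * |β| * δ) * (1 - 4 * (2 * |β|) * δ * θ₀) ^ (-(3 : ℝ) / 2)
        ≤ Real.exp (2 * |β| * δ) * Real.exp (3 * (8 * |β| * δ * θ₀)) :=
          mul_le_mul_of_nonneg_left h1 (Real.exp_pos _).le
      _ = Real.exp (|β| * δ * (2 + 24 * θ₀)) := by rw [← Real.exp_add]; ring_nf
      _ ≤ Real.exp ε := Real.exp_le_exp.2 hrate
  have hK0 : 0 ≤ Real.exp (|2 * β| * δ) * (1 - 4 * |2 * β| * δ * θ₀) ^ (-(3 : ℝ) / 2) := by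
    have : 0 < 1 - 4 * |2 * β| * δ * θ₀ := by linarith
    positivity
  have hχN' : ∫⁻ z, ENNReal.ofReal (Real.exp ((2 * β) * ∑ i : Fin (N + 1), w⁻¹ * ∫ r in (0 : ℝ)..w,
        χ ((Φ N).flow r z i).1 * (((Φ N).flow r z i).2 0 * ((Φ N).flow r z i).2 1)))
        ∂(localGibbsLaw σ (fun _ => a₀) (fun _ => 0) (fun _ => θ₀) N (Φ N)) ≤
      ENNReal.ofReal (Real.exp (ε * ((N : ℝ) + 1))) := by
    refine hχN.trans (ENNReal.ofReal_le_ofReal ?_)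
    calc (Real.exp (|2 * β| * δ) * (1 - 4 * |2 * β| * δ * θ₀) ^ (-(3 : ℝ) / 2)) ^ (N + 1)
        ≤ (Real.exp ε) ^ (N + 1) := pow_le_pow_left₀ hK0 hK _
      _ = Real.exp (ε * ((N : ℝ) + 1)) := by
          rw [← Real.exp_nat_mul]; push_cast; ring_nf
  have h0 : (0 : ℝ) ≤ 1 / 2 := by norm_num
  calc (∫⁻ z, ENNReal.ofReal (Real.exp ((2 * β) * ∑ i : Fin (N + 1), w⁻¹ * ∫ r in (0 : ℝ)..w,
          ψ ((Φ N).flow r z i).1 * (((Φ N).flow r z i).2 0 * ((Φ N).flow r z i).2 1)))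
          ∂(localGibbsLaw σ (fun _ => a₀) (fun _ => 0) (fun _ => θ₀) N (Φ N))) ^ (1 / 2 : ℝ) *
        (∫⁻ z, ENNReal.ofReal (Real.exp ((2 * β) * ∑ i : Fin (N + 1), w⁻¹ * ∫ r in (0 : ℝ)..w,
          χ ((Φ N).flow r z i).1 * (((Φ N).flow r z i).2 0 * ((Φ N).flow r z i).2 1)))
          ∂(localGibbsLaw σ (fun _ => a₀) (fun _ => 0) (fun _ => θ₀) N (Φ N))) ^ (1 / 2 : ℝ)
      ≤ ENNReal.ofReal (Real.exp (ε / 2 * ((N : ℝ) + 1))) ^ (1 / 2 : ℝ) *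
          ENNReal.ofReal (Real.exp (ε * ((N : ℝ) + 1))) ^ (1 / 2 : ℝ) :=
        mul_le_mul' (ENNReal.rpow_le_rpow hψN h0) (ENNReal.rpow_le_rpow hχN' h0)
    _ = ENNReal.ofReal (Real.exp ((3 * ε / 4) * ((N : ℝ) + 1))) := by
        rw [ofReal_exp_rpow, ofReal_exp_rpow, ← ENNReal.ofReal_mul (Real.exp_pos _).le,
          ← Real.exp_add]
        ring_nf
    _ ≤ ENNReal.ofReal (Real.exp (ε * ((N : ℝ) + 1))) :=
        ENNReal.ofReal_le_ofReal (Real.exp_le_exp.2 (by nlinarith))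

/-- **`EquilibriumShearWindowLD` from a uniform bound on a sup-norm-dense class**
(stmt-AtomisticToContinuum-14446). Let `S` be a set of test functions on `𝕋³` that approximates
every continuous function in sup norm by continuous members. If for some `σ₀ > 0`, all
`a₀, θ₀ > 0`, `σ ∈ (0, σ₀)` and every flow family the window bound holds on `S` with a tilt range
uniform in units of the sup norm (`|β| B ≤ β₀` whenever `|ψ| ≤ B`, `β₀` depending on everything but
`ψ`), then the item holds (`shearGood_of_uniform_dense` at `σ₀ ⊓ 1/2`). [folklore] -/
theorem equilibriumShearWindowLD_of_uniform_dense (S : Set (T3 → ℝ))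
    (hd : ∀ φ : T3 → ℝ, Continuous φ → ∀ δ : ℝ, 0 < δ → ∃ ψ ∈ S, Continuous ψ ∧ ∀ x, |φ x - ψ x| ≤ δ)
    (h : ∃ σ₀ : ℝ, 0 < σ₀ ∧ ∀ (a₀ θ₀ : ℝ), 0 < a₀ → 0 < θ₀ → ∀ σ : ℝ, 0 < σ → σ < σ₀ →
      ∀ Φ : (N : ℕ) → HardSphereFlow (Torus.geometry (Fin 3)) (hsDiameter σ N) (N + 1),
      ∃ β₀ : ℝ, 0 < β₀ ∧ ∀ ψ ∈ S, Continuous ψ → ∀ B : ℝ, (∀ x, |ψ x| ≤ B) →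
        ∀ β : ℝ, |β| * B ≤ β₀ → ∀ ε : ℝ, 0 < ε → ∃ τ : ℝ, 0 < τ ∧ ∃ N₀ : ℕ, ∀ N : ℕ, N₀ ≤ N →
          ∫⁻ z, ENNReal.ofReal (Real.exp (β * ∑ i : Fin (N + 1),
              (τ * ((N : ℝ) + 1) ^ (-(1 / 3 : ℝ)))⁻¹ *
                ∫ r in (0 : ℝ)..(τ * ((N : ℝ) + 1) ^ (-(1 / 3 : ℝ))),
                  ψ ((Φ N).flow r z i).1 * (((Φ N).flow r z i).2 0 * ((Φ N).flow r z i).2 1)))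
              ∂(localGibbsLaw σ (fun _ => a₀) (fun _ => 0) (fun _ => θ₀) N (Φ N)) ≤
            ENNReal.ofReal (Real.exp (ε * ((N : ℝ) + 1)))) :
    EquilibriumShearWindowLD := by
  obtain ⟨σ₀, hσ₀, h⟩ := h
  refine ⟨min σ₀ (1 / 2), lt_min hσ₀ (by norm_num), fun a₀ θ₀ ha hθ σ hσ hσσ Φ φ hφ => ?_⟩
  have hσσ₀ : σ < σ₀ := hσσ.trans_le (min_le_left _ _)
  have hσ2 : σ ≤ 1 / 2 := (hσσ.trans_le (min_le_right _ _)).le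
  obtain ⟨β₀, hβ₀, hS⟩ := h a₀ θ₀ ha hθ σ hσ hσσ₀ Φ
  exact shearGood_of_uniform_dense ha hθ hσ2 Φ S hβ₀ hS hφ (hd φ hφ)

/-! ### A concrete dense class: real parts of trigonometric polynomials -/

/-- **Real parts of trigonometric polynomials approximate continuous functions on `𝕋³` uniformly**
(Stone–Weierstrass on the torus, Mathlib's `UnitAddTorus.span_mFourier_closure_eq_top`: the span of
the Fourier monomials is dense in `C(𝕋³, ℂ)`; take real parts). [folklore] -/
theorem exists_trigPoly_re_near {φ : T3 → ℝ} (hφ : Continuous φ) {δ : ℝ} (hδ : 0 < δ) :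
    ∃ P ∈ Submodule.span ℂ (Set.range (UnitAddTorus.mFourier (d := Fin 3))),
      ∀ x, |φ x - (P x).re| ≤ δ := by
  set f : C(UnitAddTorus (Fin 3), ℂ) := ⟨fun x => (φ x : ℂ), by fun_prop⟩ with hf
  have hmem : f ∈ ((Submodule.span ℂ (Set.range (UnitAddTorus.mFourier (d := Fin 3)))).topologicalClosure :
      Set C(UnitAddTorus (Fin 3), ℂ)) := by
    rw [UnitAddTorus.span_mFourier_closure_eq_top]; trivial
  rw [Submodule.topologicalClosure_coe] at hmem
  obtain ⟨P, hP, hdist⟩ := Metric.mem_closure_iff.1 hmem δ hδ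
  refine ⟨P, hP, fun x => ?_⟩
  have h1 : |φ x - (P x).re| = |((f - P) x).re| := by
    simp [hf]
  rw [h1]
  calc |((f - P) x).re| ≤ ‖(f - P) x‖ := Complex.abs_re_le_norm _
    _ ≤ ‖f - P‖ := ContinuousMap.norm_coe_le_norm (f - P) x
    _ = dist f P := (dist_eq_norm f P).symm
    _ ≤ δ := hdist.le

/-- **`EquilibriumShearWindowLD` from a uniform bound for trigonometric polynomials**
(stmt-AtomisticToContinuum-14446): it suffices to prove the window bound for the test functions
`x ↦ Re P(x)`, `P` a trigonometric polynomial on `𝕋³` (a complex linear combination of Fourier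
monomials `UnitAddTorus.mFourier n`, `n ∈ ℤ³`), with a tilt range uniform in units of the sup norm
(`|β| B ≤ β₀` whenever `|Re P| ≤ B`; `β₀` may depend on `a₀, θ₀, σ` and the flow family) —
`equilibriumShearWindowLD_of_uniform_dense` with `exists_trigPoly_re_near`. The modewise bounds do
NOT suffice by this argument (Hölder over the `|K|` modes of an approximant multiplies the tilt by
`|K|`, which grows as the approximation improves). [folklore] -/
theorem equilibriumShearWindowLD_of_uniform_trigPoly
    (h : ∃ σ₀ : ℝ, 0 < σ₀ ∧ ∀ (a₀ θ₀ : ℝ), 0 < a₀ → 0 < θ₀ → ∀ σ : ℝ, 0 < σ → σ < σ₀ →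
      ∀ Φ : (N : ℕ) → HardSphereFlow (Torus.geometry (Fin 3)) (hsDiameter σ N) (N + 1),
      ∃ β₀ : ℝ, 0 < β₀ ∧ ∀ P ∈ Submodule.span ℂ (Set.range (UnitAddTorus.mFourier (d := Fin 3))),
        ∀ B : ℝ, (∀ x, |(P x).re| ≤ B) →
        ∀ β : ℝ, |β| * B ≤ β₀ → ∀ ε : ℝ, 0 < ε → ∃ τ : ℝ, 0 < τ ∧ ∃ N₀ : ℕ, ∀ N : ℕ, N₀ ≤ N →
          ∫⁻ z, ENNReal.ofReal (Real.exp (β * ∑ i : Fin (N + 1),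
              (τ * ((N : ℝ) + 1) ^ (-(1 / 3 : ℝ)))⁻¹ *
                ∫ r in (0 : ℝ)..(τ * ((N : ℝ) + 1) ^ (-(1 / 3 : ℝ))),
                  (P ((Φ N).flow r z i).1).re * (((Φ N).flow r z i).2 0 * ((Φ N).flow r z i).2 1)))
              ∂(localGibbsLaw σ (fun _ => a₀) (fun _ => 0) (fun _ => θ₀) N (Φ N)) ≤
            ENNReal.ofReal (Real.exp (ε * ((N : ℝ) + 1)))) :
    EquilibriumShearWindowLD := by
  set S : Set (T3 → ℝ) := {ψ | ∃ P ∈ Submodule.span ℂ (Set.range (UnitAddTorus.mFourier (d := Fin 3))),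
    ψ = fun x => (P x).re} with hS
  refine equilibriumShearWindowLD_of_uniform_dense S (fun φ hφ δ hδ => ?_) ?_
  · obtain ⟨P, hP, hPδ⟩ := exists_trigPoly_re_near hφ hδ
    exact ⟨fun x => (P x).re, ⟨P, hP, rfl⟩, Complex.continuous_re.comp P.continuous, hPδ⟩
  · obtain ⟨σ₀, hσ₀, h⟩ := h
    refine ⟨σ₀, hσ₀, fun a₀ θ₀ ha hθ σ hσ hσσ Φ => ?_⟩
    obtain ⟨β₀, hβ₀, hP⟩ := h a₀ θ₀ ha hθ σ hσ hσσ Φ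
    refine ⟨β₀, hβ₀, fun ψ hψS _ B hB β hβ ε hε => ?_⟩
    obtain ⟨P, hPm, rfl⟩ := hψS
    exact hP P hPm B hB β hβ ε hε

end Summit.AtomisticToContinuum.HydrodynamicLimit.Theorems

end
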